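import Summits.RiemannHypothesis.RiemannHypothesis.Theorems.SignConeSignConeOscillatorySignedMajorant
import Summits.RiemannHypothesis.RiemannHypothesis.Theorems.SignConeSignConeOscillatoryLever
import Summits.RiemannHypothesis.RiemannHypothesis.Theorems.SignConeSignConeOscillatorySmallNegativeMass
import Summits.RiemannHypothesis.RiemannHypothesis.Theorems.SignConeGapRungOneNumerics

/-!
# `GapRung 1`, regime `n₀ ≥ 11`: one node gap via the positive-definiteness lever
(crux `SignConeInequality`, stmt-RiemannHypothesis-16301; cell `Cruxes/SignConeInequality/`, rung `GapRung 1` of the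
gap-count ladder, registered stubs `stub_gap_mid` (`12 ≤ n₀ ≤ 112`) and `stub_gap_large` (`113 ≤ n₀`) of line `gap-rung-one`)

**Theorem (`singleGap_lever`).** Let `gᵢ` be Weil tests, `F = Σᵢ gᵢ ⋆ g̃ᵢ`, node-nonnegative (`Re F(log n) ≥ 0`, `n ≥ 2`),
whose far-field negativity `{|t| ≥ log 2, Re F(t) < 0}` lies in ONE node gap `log n₀ ≤ |t| < log (n₀+1)` with `n₀ ≥ 11`.
Then `-Re F(0) ≤ Re (weilPolarTerm F + weilArchTerm F)` — at every cutoff (the support of the `gᵢ` is not used).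

Proof (all ingredients landed): let `t₀` minimise `Re F` on the closed gap and `D = max(0, −Re F(t₀)) ∈ [0, A]`,
`A = Re F(0)` (`|Re F| ≤ A`, Bombieri's Lemma 2 summed, `abs_re_autocorrSum_le'`).  With `α = log n₀`,
`ℓ = log(n₀+1) − log n₀ ≤ t₁ = 4 log(15/14)` (needs `n₀ ≥ 4`):
* far field: `s(x) = 2 Re F(x) ≥ −2D` for `x ≥ log 2`, and `s ≥ 0` off `(α, α+ℓ]` (node hypothesis at `x = α`);
* DEFICIT from the lever (`re_le_re_zero_sub_of_dip`, file `…OscillatoryLever`): for `ℓ < x ≤ t₁` both flanks `t₀ ± x`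
  lie in the clean far field (`t₀ − x ≥ log n₀ − t₁ ≥ log 2` needs `n₀ ≥ 3`), so `Re F(x) ≤ A − D`, i.e. `s(x) ≤ 2(A − D)`;
* the signed far-field majorant (`signedFarFieldMajorant`, file `…OscillatorySignedMajorant`) then gives
  `Re W_ar(F) ≥ −A + (19/100)A + D·Φ(n₀)`, and `Φ(n₀) ≥ −19/100` for `n₀ ≥ 11` (`gapPhi_ge`, file `…GapRungOneNumerics`)
  closes since `0 ≤ D ≤ A`.
What the single allowed gap COSTS in the functional: LOSS `8D(sinh(log(n₀+1)/2) − sinh(log n₀/2)) ≈ 2D/√n₀` against the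
lever's GAIN `D(log(2n₀+1) + log(12209/89041) − (97/28)(t₁ − ℓ))`; the balance `Φ(n₀)` is `−0.245` at `n₀ = 10`, `−0.147` at
`11`, `−0.058` at `12`, positive from `13` on; the far-field margin `0.19·A` pays for `n₀ = 11, 12`.  Gaps `2 ≤ n₀ ≤ 10` are NOT
reachable by this one-scale lever (stub `stub_gap_small`).
-/

noncomputable section

-- `Summit.RiemannHypothesis.RiemannHypothesis.…` repeats a namespace component by design (D-0017 layout).
set_option linter.dupNamespace false

open scoped BigOperators ComplexConjugate
open Complex MeasureTheory Set Filter

namespace Summit.RiemannHypothesis.RiemannHypothesis.Theorems.SignCone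

open Literature.NumberTheory.LFunctions

/-- `Re F(−t) = Re F(t)` for an autocorrelation sum `F = Σᵢ gᵢ ⋆ g̃ᵢ` (`F(−t) = conj F(t)` termwise). [folklore] -/
theorem re_autocorrSum_neg {k : ℕ} {g : Fin k → ℝ → ℂ} {F : ℝ → ℂ}
    (hF : F = fun t => ∑ i, weilConv (g i) (weilReflect (g i)) t) (t : ℝ) : (F (-t)).re = (F t).re := by
  subst hF
  simp only [Complex.re_sum]
  refine Finset.sum_congr rfl fun i _ => ?_
  rw [weilConv_weilReflect_neg, Complex.conj_re]

/-- `4 log(15/14) ≤ 2/7` and `2/29·4 ≤ 4 log(15/14)`: crude bounds on `t₁`. [folklore] -/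
private lemma t₁_bounds : 8 / 29 ≤ 4 * Real.log (15 / 14) ∧ 4 * Real.log (15 / 14) ≤ 2 / 7 := by
  constructor
  · have h := Literature.Analysis.SpecialFunctions.Real.two_div_le_log_one_add_inv (a := 14) (by norm_num)
    norm_num at h
    linarith
  · have h : Real.log (15 / 14) ≤ 15 / 14 - 1 := Real.log_le_sub_one_of_pos (by norm_num)
    linarith

/-- **One node gap at `n₀ ≥ 11`, by the positive-definiteness lever** (analytic core of `stub_gap_mid` / `stub_gap_large`):
for Weil tests `gᵢ`, `F = Σᵢ gᵢ ⋆ g̃ᵢ` node-nonnegative with far-field negativity confined to `log n₀ ≤ |t| < log(n₀+1)`,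
`n₀ ≥ 11`: `-Re F(0) ≤ Re (weilPolarTerm F + weilArchTerm F)`. [folklore] -/
theorem singleGap_lever {k : ℕ} {g : Fin k → ℝ → ℂ} {F : ℝ → ℂ} {n₀ : ℕ}
    (hF : F = fun t => ∑ i, weilConv (g i) (weilReflect (g i)) t) (hg : ∀ i, IsWeilTest (g i))
    (hn₀ : 11 ≤ n₀) (hn : ∀ n : ℕ, 2 ≤ n → 0 ≤ (F (Real.log n)).re)
    (hgap : ∀ t : ℝ, Real.log 2 ≤ |t| → (F t).re < 0 → Real.log n₀ ≤ |t| ∧ |t| < Real.log (n₀ + 1)) :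
    -(F 0).re ≤ (weilPolarTerm F + weilArchTerm F).re := by
  -- Weil test, Bombieri bound, symmetry
  have hFt : IsWeilTest F := by
    rw [hF]; exact SignConeFarField.isWeilTest_sum _ fun i _ => (hg i).weilConv (hg i).weilReflect
  have hbd : ∀ t : ℝ, |(F t).re| ≤ (F 0).re := abs_re_autocorrSum_le' hF hg
  have hA : 0 ≤ (F 0).re := le_trans (abs_nonneg _) (hbd 0)
  have hsym : ∀ t : ℝ, (F (-t)).re = (F t).re := re_autocorrSum_neg hF
  -- the gap `[α, β)`, `ℓ = β - α`
  have hn0R : (11 : ℝ) ≤ n₀ := by exact_mod_cast hn₀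
  have hn0pos : (0 : ℝ) < n₀ := by linarith
  have hlog2 : 0 < Real.log 2 := Real.log_pos one_lt_two
  have hα2 : Real.log 2 ≤ Real.log (n₀ : ℝ) := Real.log_le_log two_pos (by linarith)
  have hαβ : Real.log (n₀ : ℝ) < Real.log (n₀ + 1) := Real.log_lt_log hn0pos (by linarith)
  obtain ⟨ht₁lo, ht₁hi⟩ := t₁_bounds
  -- `ℓ ≤ 1/n₀ ≤ 1/11 < 8/29 ≤ t₁`
  have hℓle : Real.log ((n₀ : ℝ) + 1) - Real.log n₀ ≤ 4 * Real.log (15 / 14) := by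
    have h1 : Real.log ((n₀ : ℝ) + 1) - Real.log n₀ = Real.log (1 + (n₀ : ℝ)⁻¹) := by
      rw [← Real.log_div (by linarith) hn0pos.ne']
      congr 1; field_simp
    have h2 : Real.log (1 + (n₀ : ℝ)⁻¹) ≤ (1 + (n₀ : ℝ)⁻¹) - 1 := Real.log_le_sub_one_of_pos (by positivity)
    have h3 : (n₀ : ℝ)⁻¹ ≤ 11⁻¹ := by
      rw [inv_le_inv₀ hn0pos (by norm_num)]; exact hn0R
    linarith
  -- `log 2 + t₁ ≤ α` (`log n₀ ≥ log 8 = 3 log 2 ≥ log 2 + 2/7`)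
  have hflank : Real.log 2 + 4 * Real.log (15 / 14) ≤ Real.log (n₀ : ℝ) := by
    have h8 : Real.log 8 ≤ Real.log (n₀ : ℝ) := Real.log_le_log (by norm_num) (by linarith)
    have e8 : Real.log 8 = 3 * Real.log 2 := by
      rw [show (8 : ℝ) = 2 ^ 3 by norm_num, Real.log_pow]; push_cast; ring
    have h2 := Real.log_two_gt_d9
    linarith
  -- clean far field off the gap
  have hclean : ∀ t : ℝ, Real.log 2 ≤ |t| → ¬ (Real.log (n₀ : ℝ) ≤ |t| ∧ |t| < Real.log (n₀ + 1)) →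
      0 ≤ (F t).re := fun t ht hng => not_lt.1 fun hneg => hng (hgap t ht hneg)
  -- the minimum of `Re F` on the closed gap
  obtain ⟨t₀, ht₀K, ht₀min⟩ := (isCompact_Icc : IsCompact (Icc (Real.log (n₀ : ℝ)) (Real.log (n₀ + 1)))).exists_isMinOn
    (nonempty_Icc.2 hαβ.le) ((Complex.continuous_re.comp hFt.1.continuous).continuousOn)
  rw [isMinOn_iff] at ht₀min
  set D : ℝ := max 0 (-(F t₀).re) with hD_def
  have hD0 : 0 ≤ D := le_max_left _ _
  have hDt₀ : -D ≤ (F t₀).re := by have := le_max_right 0 (-(F t₀).re); linarith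
  have hDA : D ≤ (F 0).re := max_le hA (by have := (abs_le.1 (hbd t₀)).1; linarith)
  have ht₀pos : 0 < t₀ := lt_of_lt_of_le hlog2 (hα2.trans ht₀K.1)
  -- (1) negativity bounded by `2D` in the far field
  have hneg : ∀ x : ℝ, Real.log 2 ≤ x → -(2 * D) ≤ (F x).re + (F (-x)).re := by
    intro x hx
    rw [hsym x]
    have hx0 : 0 ≤ x := hlog2.le.trans hx
    by_cases hxg : Real.log (n₀ : ℝ) ≤ x ∧ x < Real.log (n₀ + 1)
    · have hmin : (F t₀).re ≤ (F x).re := ht₀min x ⟨hxg.1, hxg.2.le⟩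
      linarith
    · have h0 : 0 ≤ (F x).re := hclean x (by rwa [abs_of_nonneg hx0]) (by rwa [abs_of_nonneg hx0])
      linarith
  -- (2) clean outside `(α, α + ℓ]`
  have hout : ∀ x : ℝ, Real.log 2 ≤ x →
      (x ≤ Real.log (n₀ : ℝ) ∨ Real.log (n₀ : ℝ) + (Real.log ((n₀ : ℝ) + 1) - Real.log n₀) < x) →
      0 ≤ (F x).re + (F (-x)).re := by
    intro x hx hx'
    rw [hsym x]
    have hx0 : 0 ≤ x := hlog2.le.trans hx
    suffices h : 0 ≤ (F x).re by linarith
    rcases hx' with hle | hgt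
    · rcases hle.lt_or_eq with hlt | heq
      · exact hclean x (by rwa [abs_of_nonneg hx0]) (by rw [abs_of_nonneg hx0]; exact fun h => absurd h.1 (not_le.2 hlt))
      · rw [heq]; exact hn n₀ (by omega)
    · exact hclean x (by rwa [abs_of_nonneg hx0]) (by rw [abs_of_nonneg hx0]; exact fun h => by linarith [h.2])
  -- (3) the deficit from the lever
  have hdef : ∀ x : ℝ, Real.log ((n₀ : ℝ) + 1) - Real.log n₀ < x → x ≤ 4 * Real.log (15 / 14) →
      (F x).re + (F (-x)).re ≤ 2 * ((F 0).re - D) := by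
    intro x hxℓ hxt
    rw [hsym x]
    by_cases hpos : 0 ≤ (F t₀).re
    · have hD : D = 0 := by rw [hD_def]; exact max_eq_left (by linarith)
      have := (abs_le.1 (hbd x)).2
      rw [hD]; linarith
    · push Not at hpos
      have hD : D = -(F t₀).re := by rw [hD_def]; exact max_eq_right (by linarith)
      have ht : (F t₀).re ≤ -D := by rw [hD]; simp
      -- right flank: beyond the gap
      have hp0 : 0 ≤ t₀ + x := by linarith [ht₀K.1, hα2, hlog2.le]
      have hp : 0 ≤ (F (t₀ + x)).re := by
        refine hclean _ ?_ ?_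
        · rw [abs_of_nonneg hp0]; linarith [ht₀K.1, hα2]
        · rw [abs_of_nonneg hp0]
          rintro ⟨_, h2⟩
          linarith [ht₀K.1]
      -- left flank: below the gap, still in the far field
      have hm0 : 0 ≤ t₀ - x := by linarith [ht₀K.1, hflank, hlog2.le]
      have hm : 0 ≤ (F (t₀ - x)).re := by
        refine hclean _ ?_ ?_
        · rw [abs_of_nonneg hm0]; linarith [ht₀K.1, hflank]
        · rw [abs_of_nonneg hm0]
          rintro ⟨h1, _⟩
          linarith [ht₀K.2]
      have key := re_le_re_zero_sub_of_dip hg hF (t := t₀) (u := x) (D := D) ht hp hm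
      linarith
  -- (4) the signed far-field majorant with the excursion `(α, α + ℓ]`
  have hmaj := signedFarFieldMajorant F hFt (D := D) (α := Real.log (n₀ : ℝ))
    (ℓ := Real.log ((n₀ : ℝ) + 1) - Real.log n₀) hbd hD0 hDA hα2 (by linarith) hℓle hneg hout hdef
  -- (5) the constant: `Φ(n₀) ≥ -19/100`
  have hΦ := gapPhi_ge n₀ hn₀
  have hDΦ := mul_le_mul_of_nonneg_left hΦ hD0
  nlinarith [hmaj, hDΦ, hDA, hD0, hA]

end Summit.RiemannHypothesis.RiemannHypothesis.Theorems.SignCone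

end
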